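import Summits.BirchSwinnertonDyer.BirchSwinnertonDyer.Theorems.ByReductionTypeAtTwoTowerLayerSharp
import Summits.BirchSwinnertonDyer.Rank1Residual.X5.TwoAdicInstancesToolkitB
import Summits.BirchSwinnertonDyer.Rank1Residual.X5.TwoAdicImageCertificates
import Literature.NumberTheory.EllipticCurves.SkinnerUrban2014.PAdicUnitPeriodRatioAnyPrimeProofs
import Literature.NumberTheory.EllipticCurves.Rank1Residual.PeriodUnitProofs
import Literature.NumberTheory.EllipticCurves.Rank1Residual.PrintShape
import Literature.NumberTheory.EllipticCurves.ModifiedTamagawaProduct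
import Literature.NumberTheory.DiophantineGeometry.LocalReductionHasMultiplicativeReductionAtProofs
import Literature.NumberTheory.EllipticCurves.SzpiroLocalDataProofs
import Literature.NumberTheory.DiophantineGeometry.MinimalDiscriminantNormProofs
import Literature.NumberTheory.DiophantineGeometry.LocalReductionFiniteBadPlacesProofs
import Literature.NumberTheory.EllipticCurves.IsogenyIdProofs
import Literature.NumberTheory.EllipticCurves.ShortWeierstrassGoodTwistLocalProofs
import HarnessLib

/-!
# TOWER-road class instances — the KIT: generic curve-data lemmas shared by every per-class file
# (route ByReductionTypeAtTwo, crux `OrdKatoHalfAtTwo` 19271 / `OrdKatoHalfAtTwoIso` 19573; seat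
# bsd-2adic-ord-2, GEN 3)

HONEST FRAMING (cell `bsd-2adic`, run/shared/lean/pub/bsd-2adic/, HUMAN RULINGS D-0036 / D-0054 / D-0074):
THEOREMS ONLY; nothing asserted; no new named fact; closes nothing by itself. These are the reusable
pieces of the per-class TOWER instance files (`…TowerClass<label>.lean`), in the `𝓞 ℚ`-place currency of
the tower doors (`Theorems/ByReductionTypeAtTwoTowerLayer{Gap,Greenberg,Sharp}.lean`) and of Greenberg's
local-kernel readings (`Literature/…/Greenberg1999/ControlLocalKernelsLayer.lean`):

* `not_two_dvd_torsionOrder_of_irr` — `E[2]` irreducible ⇒ `2 ∤ #E(ℚ)_tors` (the `htors` binder);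
* `periodRatio_nonneg_of_irr_two_of_abbesUllmo` — the Néron-period integrality binder `hper₀` of every
  tower door is PRINT on the `E[2]`-irreducible good-at-`2` locus: Abbes–Ullmo 1996 Thm. A (named fact
  `abbesUllmo_not_dvd_maninConstant_of_not_dvd_level`) via the tree theorem
  `SkinnerUrban2014.realPeriodRat_eq_unit_mul_plusPeriod_two_of_abbesUllmo` — so NO period certificate is
  displayed on the 440 irreducible classes;
* for an integer model `M` and a place `v` of `𝓞 ℚ` over `ℓ = natGenerator v`: good reduction from
  `ℓ ∤ Δ(M)`, multiplicative reduction from `ℓ ∣ Δ(M)`, `ℓ ∤ c₄(M)`, and `ord_v Δ_min = e` from a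
  factorisation `Δ(M) = ℓ^e · u`, `ℓ ∤ u` (Silverman VII.1 Rem. 1.1 / Prop. 1.3, VII.5.1);
* bookkeeping on places: `2 ∈ v ↔ natGenerator v = 2` (`natGenerator (primesEquiv⁻¹ p) = p` is the tree's
  `natGenerator_primesEquiv_symm_ringOfIntegers`).

References: [SilvermanAEC2009] VII.1, VII.5, X.4.2; [AbbesUllmo1996] Thm. A; [GreenbergVatsal2000] §3 Rem. 3.4.
-/

set_option autoImplicit false

noncomputable section

open scoped Classical MatrixGroups ModularForm

open NumberField IsDedekindDomain CongruenceSubgroup WeierstrassCurve Literature.NumberTheory.EllipticCurves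
  Literature.NumberTheory.EllipticCurves.ModularForms Literature.NumberTheory.EllipticCurves.Rank1Residual
  Literature.NumberTheory.EllipticCurves.Rank1Residual.Typed
  Literature.NumberTheory.EllipticCurves.Greenberg1999
  Literature.NumberTheory.EllipticCurves.SkinnerUrban2014
  Literature.NumberTheory.GaloisRepresentations
  Summit.BirchSwinnertonDyer.Rank1Residual.X5 Summit.BirchSwinnertonDyer.Rank1Residual.X5.O1
  Summit.BirchSwinnertonDyer.Rank1Residual.X5.Instances
  Summit.BirchSwinnertonDyer.BirchSwinnertonDyer.Theorems.KatoHalfPinch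
  Summit.BirchSwinnertonDyer.BirchSwinnertonDyer.Theorems.Rank1ResidualX1Defs

namespace Summit.BirchSwinnertonDyer.BirchSwinnertonDyer.Theorems.TowerClass

/-! ## §1 Generic helpers (any globally minimal `W/ℚ`; reusable by every tower class file) -/

section Generic

variable (W : WeierstrassCurve ℚ) [W.IsElliptic] [W.IsGloballyMinimal]

omit [W.IsGloballyMinimal] in
/-- `E[2]` irreducible ⇒ `2 ∤ #E(ℚ)_tors` (a rational point of order `2` spans a stable line).
[cite: SilvermanAEC2009, III.2.3 (b) and X.4.2 (a)] -/
theorem not_two_dvd_torsionOrder_of_irr (hirr : Irr W 2) : ¬ 2 ∣ W.torsionOrder := by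
  intro hdvd
  have h0 := padicValNat_torsionOrder_eq_zero_of_irreducible W 2 hirr
  rw [padicValNat.eq_zero_iff] at h0
  rcases h0 with h | h | h
  · exact absurd h (by norm_num)
  · exact W.torsionOrder_pos_holds.ne' h
  · exact h hdvd

/-- **Néron-period integrality is PRINT on the `E[2]`-irreducible good-at-`2` locus** (Abbes–Ullmo 1996
Thm. A via Greenberg–Vatsal Rem. 3.4: `Ω(W) = u·Ω⁺_f` with `‖u‖₂ = 1`, so every `ϖ` with
`ϖ·Ω(W) = Ω⁺_f` has `ord₂ ϖ = 0 ≥ 0`) — the `hper₀` binder of every tower door, discharged modulo the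
named fact `hAU`. [cite: AbbesUllmo1996, Thm. A] [cite: GreenbergVatsal2000, §3, Remark 3.4] -/
theorem periodRatio_nonneg_of_irr_two_of_abbesUllmo
    (hAU : abbesUllmo_not_dvd_maninConstant_of_not_dvd_level) (hgo : GoodOrd W 2) (hirr : Irr W 2) :
    ∀ [NeZero (W.conductorNorm ℤ)] (f : CuspForm (Gamma0 (W.conductorNorm ℤ)) 2),
      IsNewformOf W f → ∀ ϖ : ℚ, (ϖ : ℝ) * W.realPeriodRat = plusPeriod f → 0 ≤ padicValRat 2 ϖ := by
  intro _ f hf ϖ hϖ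
  have hgood : W.HasGoodReductionAtPrime 2 := (show IsOrdinaryAt W 2 from hgo).1
  obtain ⟨u, hu, hΩ⟩ := realPeriodRat_eq_unit_mul_plusPeriod_two_of_abbesUllmo hAU W hgood hirr f hf
  exact (Rank1Residual.padicValRat_periodRatio_eq_zero_of_eq_unit_mul W 2 f hu hΩ ϖ hϖ).ge

end Generic

section Places

open Rat.HeightOneSpectrum

/-- `2 ∉ v` when the prime under `v` is not `2`. [folklore] -/
theorem two_notMem_asIdeal_of_natGenerator_ne (v : HeightOneSpectrum (𝓞 ℚ)) (h : natGenerator v ≠ 2) :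
    ((2 : ℕ) : 𝓞 ℚ) ∉ v.asIdeal := fun hmem =>
  h ((Nat.prime_dvd_prime_iff_eq (prime_natGenerator v) Nat.prime_two).mp
    ((Rat.natCast_mem_asIdeal_iff v).mp hmem))

/-- `2 ∈ v` when the prime under `v` is `2`. [folklore] -/
theorem two_mem_asIdeal_of_natGenerator_eq (v : HeightOneSpectrum (𝓞 ℚ)) (h : natGenerator v = 2) :
    ((2 : ℕ) : 𝓞 ℚ) ∈ v.asIdeal :=
  (Rat.natCast_mem_asIdeal_iff v).mpr (h ▸ dvd_rfl)

variable (M : WeierstrassCurve ℤ)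

/-- **Good reduction of an integer model at a place over `ℓ ∤ Δ`** (`𝓞 ℚ`-place currency).
[cite: SilvermanAEC2009, VII.5 Prop. 5.1 (a)] -/
theorem hasGoodReductionAt_intModel_of_not_dvd (v : HeightOneSpectrum (𝓞 ℚ))
    (hd : ¬ (natGenerator v : ℤ) ∣ M.Δ) : (M.baseChange ℚ).HasGoodReductionAt v :=
  hasGoodReductionAt_of_valuation_Δ_eq_one_holds v (M.baseChange ℚ) (isIntegralAt_baseChange_intModel M v)
    (valuation_Δ_baseChange_int_eq_one M v (prime_natGenerator v)
      ((Rat.natCast_mem_asIdeal_iff v).mpr dvd_rfl) hd)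

/-- **Multiplicative reduction of an integer model at a place over `ℓ ∣ Δ`, `ℓ ∤ c₄`** (`𝓞 ℚ`-place
currency; Silverman VII.5.1 (b) with minimality from `v(c₄) = 0`). [cite: SilvermanAEC2009, VII.5 Prop. 5.1 (b)] -/
theorem hasMultiplicativeReductionAt_intModel (v : HeightOneSpectrum (𝓞 ℚ)) [(M.baseChange ℚ).IsElliptic]
    (hΔ : (natGenerator v : ℤ) ∣ M.Δ) (hc₄ : ¬ (natGenerator v : ℤ) ∣ M.c₄) :
    (M.baseChange ℚ).HasMultiplicativeReductionAt v := by
  refine hasMultiplicativeReductionAt_of_valuation_c₄_eq_one (isIntegralAt_baseChange_intModel M v) ?_ ?_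
  · rw [baseChange_int_c₄]; exact Rat.valuation_intCast_eq_one v hc₄
  · rw [baseChange_int_Δ]
    refine lt_of_le_of_lt (Rat.valuation_intCast_le v (e := 1) (by simpa using hΔ)) ?_
    rw [← WithZero.exp_zero, WithZero.exp_lt_exp]; norm_num

/-- **`ord_v Δ_min` of an integer model, read off the factorisation `Δ = ℓ^e · u`, `ℓ ∤ u`, at a place
over `ℓ ∤ c₄`** (the model is minimal at `v`, Silverman VII.1 Rem. 1.1, and `v(Δ) = exp(−ord_v Δ_min)`).
[cite: SilvermanAEC2009, VII.1 Remark 1.1 and Prop. 1.3] -/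
theorem ordMinimalDiscriminant_intModel_eq (v : HeightOneSpectrum (𝓞 ℚ)) [(M.baseChange ℚ).IsElliptic]
    {e : ℕ} {u : ℤ} (hfac : M.Δ = (natGenerator v : ℤ) ^ e * u) (hu : ¬ (natGenerator v : ℤ) ∣ u)
    (hc₄ : ¬ (natGenerator v : ℤ) ∣ M.c₄) : (M.baseChange ℚ).ordMinimalDiscriminant v = e := by
  have hmin : (M.baseChange ℚ).IsMinimalAt v :=
    isMinimalAt_of_valuation_c₄_eq_one (isIntegralAt_baseChange_intModel M v)
      (by rw [baseChange_int_c₄]; exact Rat.valuation_intCast_eq_one v hc₄)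
  have h1 := valuation_Δ_eq_of_isMinimalAt_holds v (M.baseChange ℚ) hmin
  have h2 : v.valuation ℚ (M.baseChange ℚ).Δ = WithZero.exp (-(e : ℤ)) := by
    rw [baseChange_int_Δ, hfac]; push_cast
    rw [map_mul, map_pow, Rat.valuation_natGenerator, Rat.valuation_intCast_eq_one v hu, mul_one,
      ← WithZero.exp_nsmul, smul_neg, nsmul_eq_mul, mul_one]
  rw [h1] at h2
  have h3 := WithZero.exp_injective h2
  omega

end Places

end Summit.BirchSwinnertonDyer.BirchSwinnertonDyer.Theorems.TowerClass

end
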